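import Literature.Computability.MetaComplexity.OrderParityExtension
import HarnessLib

/-!
# Parity constraints on linear orders with witnesses (Gryaznov–Ovcharov–Riazanov 2024, Proposition 1 for `DLO_n`)

The combinatorial core of the tree-like Res(⊕) lower bound for the DENSE LINEAR ORDERING principle
`DLO_n` [GOR 2024, §3.1.3; Gryaznov 2019, §3.3]. As in `OrderParitySystems.lean` a linear order on a
ground set `S ⊆ ℕ` is a ranking `r : ℕ → ℕ` injective on `S`; in addition an assignment carries a
WITNESS SET `W` of triples `(i, k, j)` (the true variables `z_{ikj}`, "`k` witnesses `i ≺ j`"), proper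
when `r i < r k < r j` for each of them (`WProper`). A linear form in the variables `x_{kl}, z_{ikj}` is a
pair `F = (T, Z)` of a set of ordered pairs and a set of triples, with value
`pairParity r T + wParity W Z`, `wParity W Z = |Z ∩ W| mod 2`.

* **Proposition 1′** (`OrderParity.exists_ranking_witness`, in `DLOParityExtension.lean`)
  [GOR 2024, Prop. 1, in ranking language and WITHOUT the printed restriction on the witnesses]: if
  `|S| ≥ |Φ| + 3`, `r` solves the forms of `Φ` with the empty witness set and `r s < r t`, then some
  proper `(r', W)` gives every form of `Φ` the same value and contains a witness `(s, k, t)`.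
* This file: the value bookkeeping (`wParity`, symmetric differences, odd-fibre images of triples
  `glueTriple`, lifted witness sets `liftWit`), the FINAL CASE of the printed proof
  (`exists_ranking_witness_final`: no occurring pair starts at or above `t` or ends at or below `s` ⇒
  move `s` to the bottom and `t` to the top, then switch on a nonempty set of witnesses `z_{skt}` of
  even parity on every form — pigeonhole `exists_nonempty_even_subset`), and the GLUING STEP
  (`glue_step`: from a solution of the glued system on `S ∖ {v}` to a solution on `S`, re-inserting `v`
  next to `u` on the side dictated by the separated form).

Differences from print (stated): forms are compared by value with the reference order (no right-hand
sides); gluing is the odd-fibre image on pairs AND triples; witnesses are copied to the re-inserted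
element (`liftWit` = preimage under gluing), which is what makes the glued `z`-parities match — the
printed conclusion "`τ(z_{ikj}) = 1` only if `i = s` and `j = t`" is therefore NOT kept (it can fail
for the printed construction when the glued pair starts at `t`); the reduction of Lemma 4 is made
independent of it in `DLOResLinTreeLike.lean`.

## References

* S. Gryaznov, S. Ovcharov, A. Riazanov, ACM Trans. Comput. Theory 16(3) (2024) = arXiv:2404.08370,
  §3.1.3, Proposition 1, Lemma 4, Theorem 5 [GryaznovOvcharovRiazanov2024].
* S. Gryaznov, CSR 2019, LNCS 11532, §3.3 [Gryaznov2019].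
-/

namespace Literature.Computability.MetaComplexity

namespace OrderParity

open Finset

/-! ### Values of forms with witnesses -/

/-- Sums of `𝔽₂`-valued functions add under symmetric difference. [folklore] -/
theorem sum_symmDiff_zmod2 {α : Type*} [DecidableEq α] (f : α → ZMod 2) (T U : Finset α) :
    ∑ x ∈ symmDiff T U, f x = ∑ x ∈ T, f x + ∑ x ∈ U, f x := by
  have hT := Finset.sum_inter_add_sum_sdiff T U f
  have hU := Finset.sum_inter_add_sum_sdiff U T f
  have hsd : symmDiff T U = T \ U ∪ U \ T := symmDiff_def T U
  rw [hsd, Finset.sum_union disjoint_sdiff_sdiff, ← hT, ← hU, Finset.inter_comm U T]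
  set c := ∑ x ∈ T ∩ U, f x
  calc ∑ x ∈ T \ U, f x + ∑ x ∈ U \ T, f x
      = (∑ x ∈ T \ U, f x + ∑ x ∈ U \ T, f x) + (c + c) := by
        rw [CharTwo.add_self_eq_zero, add_zero]
    _ = c + ∑ x ∈ T \ U, f x + (c + ∑ x ∈ U \ T, f x) := by ring

/-- The `z`-part of the value of a form: the parity of the number of its triples that are witnesses,
`|Z ∩ W| mod 2` — the value of `Σ_{(i,k,j) ∈ Z} z_{ikj}` under the witness set `W`.
[Gryaznov–Ovcharov–Riazanov 2024, §3.1.3 ("`z_{ikj}` encodes that `k` is a 'witness' of `i ≺ j`")]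
[cite: GryaznovOvcharovRiazanov2024, §3.1.3] -/
def wParity (W Z : Finset (ℕ × ℕ × ℕ)) : ZMod 2 :=
  ∑ τ ∈ Z, if τ ∈ W then 1 else 0

/-- No witnesses, no contribution. [folklore] -/
theorem wParity_empty (Z : Finset (ℕ × ℕ × ℕ)) : wParity ∅ Z = 0 := by
  simp [wParity]

/-- `z`-parities add under symmetric difference of forms. [folklore] -/
theorem wParity_symmDiff (W Z Z₀ : Finset (ℕ × ℕ × ℕ)) :
    wParity W (symmDiff Z Z₀) = wParity W Z + wParity W Z₀ :=
  sum_symmDiff_zmod2 _ Z Z₀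

/-- A PROPER witness set for the ranking `r` on the ground set `S`: every witness `(i, k, j)` lies in
`S` and satisfies `i ≺ k ≺ j` (the clauses `¬z_{ikj} ∨ x_{ik}`, `¬z_{ikj} ∨ x_{kj}` of `WORDER_n`).
[Gryaznov–Ovcharov–Riazanov 2024, §3.1.3 ("Semantics for `z`'s")] [cite: GryaznovOvcharovRiazanov2024, §3.1.3] -/
def WProper (S : Finset ℕ) (r : ℕ → ℕ) (W : Finset (ℕ × ℕ × ℕ)) : Prop :=
  ∀ τ ∈ W, (τ.1 ∈ S ∧ τ.2.1 ∈ S ∧ τ.2.2 ∈ S) ∧ r τ.1 < r τ.2.1 ∧ r τ.2.1 < r τ.2.2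

/-! ### Gluing on triples and lifted witness sets -/

/-- Glue `j` into `i` in a triple. [Gryaznov–Ovcharov–Riazanov 2024, Prop. 1 (proof: "syntactically
replace each occurrence of `j` … with `i`")] [cite: GryaznovOvcharovRiazanov2024, Proposition 1] -/
def glueTriple (i j : ℕ) (τ : ℕ × ℕ × ℕ) : ℕ × ℕ × ℕ :=
  (glue i j τ.1, glue i j τ.2.1, glue i j τ.2.2)

/-- The LIFTED witness set: a triple over `S` is a witness iff its glued triple is a witness of the
glued solution (`j` inherits the witnesses of `i`). [Gryaznov–Ovcharov–Riazanov 2024, Prop. 1 (proof: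
"extend `τ` by adding `j` and placing immediately before of after `i`")]
[cite: GryaznovOvcharovRiazanov2024, Proposition 1] -/
def liftWit (S : Finset ℕ) (i j : ℕ) (W' : Finset (ℕ × ℕ × ℕ)) : Finset (ℕ × ℕ × ℕ) :=
  (S ×ˢ S ×ˢ S).filter fun τ => glueTriple i j τ ∈ W'

/-- Membership in the lifted witness set, for a witness set proper on `S ∖ {j}`. [folklore] -/
theorem mem_liftWit_iff {S : Finset ℕ} {r₁ : ℕ → ℕ} {i j : ℕ} {W' : Finset (ℕ × ℕ × ℕ)}
    (hW' : WProper (S.erase j) r₁ W') (hj : j ∈ S) (τ : ℕ × ℕ × ℕ) :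
    τ ∈ liftWit S i j W' ↔ glueTriple i j τ ∈ W' := by
  unfold liftWit
  rw [Finset.mem_filter, Finset.mem_product, Finset.mem_product]
  constructor
  · exact fun h => h.2
  · intro h
    obtain ⟨⟨h1, h2, h3⟩, -⟩ := hW' _ h
    have back : ∀ {y : ℕ}, glue i j y ∈ S.erase j → y ∈ S := by
      intro y hy
      unfold glue at hy
      split_ifs at hy with hyj
      · rw [hyj]; exact hj
      · exact Finset.mem_of_mem_erase hy
    exact ⟨⟨back h1, back h2, back h3⟩, h⟩

/-- **Lifted witnesses realise the glued `z`-parities.** [Gryaznov–Ovcharov–Riazanov 2024, Prop. 1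
(proof)] [cite: GryaznovOvcharovRiazanov2024, Proposition 1] -/
theorem wParity_liftWit {S : Finset ℕ} {r₁ : ℕ → ℕ} {i j : ℕ} {W' : Finset (ℕ × ℕ × ℕ)}
    (hW' : WProper (S.erase j) r₁ W') (hj : j ∈ S) (Z : Finset (ℕ × ℕ × ℕ)) :
    wParity (liftWit S i j W') Z = wParity W' (parityImage (glueTriple i j) Z) := by
  unfold wParity
  rw [sum_parityImage]
  refine Finset.sum_congr rfl fun τ _ => ?_
  by_cases h : glueTriple i j τ ∈ W'
  · rw [if_pos h, if_pos ((mem_liftWit_iff hW' hj τ).2 h)]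
  · rw [if_neg h, if_neg fun h' => h ((mem_liftWit_iff hW' hj τ).1 h')]

/-- The lifts preserve strict comparisons of glued elements. [folklore] -/
theorem lifts_lt_of_glue_lt {r₁ : ℕ → ℕ} {i j a b : ℕ} (h : r₁ (glue i j a) < r₁ (glue i j b)) :
    liftAfter r₁ i j a < liftAfter r₁ i j b ∧ liftBefore r₁ i j a < liftBefore r₁ i j b := by
  unfold glue at h
  unfold liftAfter liftBefore
  by_cases ha : a = j <;> by_cases hb : b = j
  · simp only [ha, hb, if_true] at h ⊢; omega
  · simp only [ha, hb, if_true, if_false] at h ⊢; omega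
  · simp only [ha, hb, if_true, if_false] at h ⊢; omega
  · simp only [ha, hb, if_false] at h ⊢; omega

/-- **Lifted witnesses are proper** under both lifts. [Gryaznov–Ovcharov–Riazanov 2024, Prop. 1
(proof)] [cite: GryaznovOvcharovRiazanov2024, Proposition 1] -/
theorem wProper_liftWit {S : Finset ℕ} {r₁ : ℕ → ℕ} {i j : ℕ} {W' : Finset (ℕ × ℕ × ℕ)}
    (hW' : WProper (S.erase j) r₁ W') (hj : j ∈ S) :
    WProper S (liftAfter r₁ i j) (liftWit S i j W') ∧
      WProper S (liftBefore r₁ i j) (liftWit S i j W') := by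
  constructor
  · intro τ hτ
    have hmem := (mem_liftWit_iff hW' hj τ).1 hτ
    unfold liftWit at hτ
    rw [Finset.mem_filter, Finset.mem_product, Finset.mem_product] at hτ
    obtain ⟨-, h12, h23⟩ := hW' _ hmem
    exact ⟨⟨hτ.1.1, hτ.1.2.1, hτ.1.2.2⟩, (lifts_lt_of_glue_lt h12).1, (lifts_lt_of_glue_lt h23).1⟩
  · intro τ hτ
    have hmem := (mem_liftWit_iff hW' hj τ).1 hτ
    unfold liftWit at hτ
    rw [Finset.mem_filter, Finset.mem_product, Finset.mem_product] at hτ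
    obtain ⟨-, h12, h23⟩ := hW' _ hmem
    exact ⟨⟨hτ.1.1, hτ.1.2.1, hτ.1.2.2⟩, (lifts_lt_of_glue_lt h12).2, (lifts_lt_of_glue_lt h23).2⟩

/-- The bit of the REVERSED glued pair `(j, i)` under the lifts: `0` after, `1` before. [folklore] -/
theorem cmpBit_lifts_swap_self (r₁ : ℕ → ℕ) {i j : ℕ} (hij : i ≠ j) :
    cmpBit (liftAfter r₁ i j) (j, i) = 0 ∧ cmpBit (liftBefore r₁ i j) (j, i) = 1 := by
  unfold cmpBit liftAfter liftBefore
  simp only [if_neg hij, if_true]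
  constructor
  · rw [if_neg (by omega)]
  · rw [if_pos (by omega)]

/-! ### The final case: `s` to the bottom, `t` to the top, witnesses switched on -/

/-- **The final case of Proposition 1** [Gryaznov–Ovcharov–Riazanov 2024, Prop. 1 (proof: "For the
remaining case, we showed that there is another solution `σ′` that has `s` as the minimum and `t` as
the maximum. Hence, any other element can be taken as a witness of `s ≺ t` … The resulting system has
`n − 2` variables, at most `n − 3` equations, and has an all-zero solution. Thus, it has at least one
other solution with some `z_{skt}` set to `1`")]: if no occurring pair starts at or above `t` or ends
at or below `s`, move `s` to the bottom and `t` to the top (no occurring bit changes) and switch on a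
nonempty set of witnesses `(s, k, t)` of even parity on every form.
[cite: GryaznovOvcharovRiazanov2024, Proposition 1] -/
theorem exists_ranking_witness_final {S : Finset ℕ} {r : ℕ → ℕ} (hr : Set.InjOn r S) {s t : ℕ}
    (hs : s ∈ S) (ht : t ∈ S) (hst : r s < r t)
    {Φ : List (Finset (ℕ × ℕ) × Finset (ℕ × ℕ × ℕ))} (hlen : Φ.length + 3 ≤ S.card)
    (hΦ : ∀ F ∈ Φ, ∀ p ∈ F.1, p.1 ∈ S ∧ p.2 ∈ S ∧ r p.1 < r p.2)
    (hfree : ∀ F ∈ Φ, ∀ p ∈ F.1, r p.1 < r t ∧ r s < r p.2) :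
    ∃ (r' : ℕ → ℕ) (W : Finset (ℕ × ℕ × ℕ)), Set.InjOn r' S ∧ WProper S r' W ∧
      (∀ F ∈ Φ, pairParity r' F.1 + wParity W F.2 = pairParity r F.1) ∧ ∃ k, (s, k, t) ∈ W := by
  classical
  have hst' : s ≠ t := fun h => by rw [h] at hst; exact lt_irrefl _ hst
  -- the bound `B` and the new ranking
  set B : ℕ := S.sup r + 1 with hB
  have hltB : ∀ y ∈ S, r y < B := fun y hy => Nat.lt_succ_of_le (Finset.le_sup hy)
  set r₂ : ℕ → ℕ := fun y => if y = s then 0 else if y = t then 2 * B else r y + 1 with hr₂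
  have hr₂s : r₂ s = 0 := by simp [hr₂]
  have hr₂t : r₂ t = 2 * B := by simp [hr₂, Ne.symm hst']
  have hr₂o : ∀ {y}, y ≠ s → y ≠ t → r₂ y = r y + 1 := fun h1 h2 => by simp [hr₂, h1, h2]
  -- the columns `k ∉ {s, t}` and an even nonempty set of witnesses
  set I : Finset ℕ := (S.erase s).erase t with hI
  have hIcard : Φ.length < I.card := by
    rw [hI, Finset.card_erase_of_mem (Finset.mem_erase.2 ⟨Ne.symm hst', ht⟩),
      Finset.card_erase_of_mem hs]
    omega
  set Φlin : List LinLit := Φ.map fun F => (I.filter fun k => (s, k, t) ∈ F.2, false) with hΦlin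
  obtain ⟨U, hUI, hUne, hUeven⟩ :=
    exists_nonempty_even_subset I Φlin (by rw [hΦlin, List.length_map]; exact hIcard)
  have hUmem : ∀ k ∈ U, k ∈ S ∧ k ≠ s ∧ k ≠ t := by
    intro k hk
    have := hUI hk
    rw [hI, Finset.mem_erase, Finset.mem_erase] at this
    exact ⟨this.2.2, this.2.1, this.1⟩
  set W : Finset (ℕ × ℕ × ℕ) := U.image fun k => (s, k, t) with hW
  refine ⟨r₂, W, ?_, ?_, ?_, ?_⟩
  · -- injective on `S`
    intro y hy y' hy' h
    by_cases hys : y = s <;> by_cases hy's : y' = s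
    · rw [hys, hy's]
    · by_cases hy't : y' = t
      · rw [hys, hy't, hr₂s, hr₂t] at h; omega
      · rw [hys, hr₂s, hr₂o hy's hy't] at h; omega
    · by_cases hyt : y = t
      · rw [hy's, hyt, hr₂s, hr₂t] at h; omega
      · rw [hy's, hr₂s, hr₂o hys hyt] at h; omega
    · by_cases hyt : y = t <;> by_cases hy't : y' = t
      · rw [hyt, hy't]
      · rw [hyt, hr₂t, hr₂o hy's hy't] at h; have := hltB y' hy'; omega
      · rw [hy't, hr₂t, hr₂o hys hyt] at h; have := hltB y hy; omega
      · rw [hr₂o hys hyt, hr₂o hy's hy't] at h; exact hr hy hy' (by omega)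
  · -- proper witnesses: `s ≺ k ≺ t`
    intro τ hτ
    rw [hW, Finset.mem_image] at hτ
    obtain ⟨k, hk, rfl⟩ := hτ
    obtain ⟨hkS, hks, hkt⟩ := hUmem k hk
    refine ⟨⟨hs, hkS, ht⟩, ?_, ?_⟩
    · show r₂ s < r₂ k
      rw [hr₂s, hr₂o hks hkt]; omega
    · show r₂ k < r₂ t
      rw [hr₂t, hr₂o hks hkt]; have := hltB k hkS; omega
  · -- values: no occurring bit changes, and the witnesses are even on every form
    intro F hF
    have hx : pairParity r₂ F.1 = pairParity r F.1 := by
      unfold pairParity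
      refine Finset.sum_congr rfl fun p hp => ?_
      obtain ⟨h1, h2, hlt⟩ := hΦ F hF p hp
      obtain ⟨h1t, hs2⟩ := hfree F hF p hp
      have hp1t : p.1 ≠ t := fun h => by rw [h] at h1t; exact lt_irrefl _ h1t
      have hp2s : p.2 ≠ s := fun h => by rw [h] at hs2; exact lt_irrefl _ hs2
      have hnew : r₂ p.1 < r₂ p.2 := by
        by_cases hp1s : p.1 = s <;> by_cases hp2t : p.2 = t
        · rw [hp1s, hp2t, hr₂s, hr₂t]; omega
        · rw [hp1s, hr₂s, hr₂o hp2s hp2t]; omega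
        · rw [hp2t, hr₂t, hr₂o hp1s hp1t]; have := hltB p.1 h1; omega
        · rw [hr₂o hp1s hp1t, hr₂o hp2s hp2t]; omega
      unfold cmpBit; rw [if_pos hnew, if_pos hlt]
    have hz : wParity W F.2 = 0 := by
      have h0 := hUeven (I.filter fun k => (s, k, t) ∈ F.2, false)
        (by rw [hΦlin, List.mem_map]; exact ⟨F, hF, rfl⟩)
      simp only [parityIn] at h0
      -- both sides count the `k ∈ U` with `(s, k, t) ∈ F.2`
      have hlhs : wParity W F.2 = ∑ k ∈ U.filter (fun k => (s, k, t) ∈ F.2), (1 : ZMod 2) := by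
        unfold wParity
        rw [← Finset.sum_filter]
        refine Finset.sum_bij' (fun τ _ => τ.2.1) (fun k _ => (s, k, t)) ?_ ?_ ?_ ?_ ?_
        · intro τ hτ
          rw [Finset.mem_filter] at hτ ⊢
          obtain ⟨hτZ, hτW⟩ := hτ
          rw [hW, Finset.mem_image] at hτW
          obtain ⟨k, hk, rfl⟩ := hτW
          exact ⟨hk, hτZ⟩
        · intro k hk
          rw [Finset.mem_filter] at hk ⊢
          exact ⟨hk.2, by rw [hW]; exact Finset.mem_image_of_mem _ hk.1⟩
        · intro τ hτ
          rw [Finset.mem_filter] at hτ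
          obtain ⟨-, hτW⟩ := hτ
          rw [hW, Finset.mem_image] at hτW
          obtain ⟨k, -, rfl⟩ := hτW
          rfl
        · intro k _; rfl
        · intro τ _; rfl
      have hrhs : ∑ v ∈ I.filter (fun k => (s, k, t) ∈ F.2), (if v ∈ U then (1 : ZMod 2) else 0) =
          ∑ k ∈ U.filter (fun k => (s, k, t) ∈ F.2), (1 : ZMod 2) := by
        rw [← Finset.sum_filter]
        refine Finset.sum_congr ?_ fun _ _ => rfl
        ext k
        simp only [Finset.mem_filter]
        constructor
        · rintro ⟨⟨-, h1⟩, h2⟩; exact ⟨h2, h1⟩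
        · rintro ⟨h1, h2⟩; exact ⟨⟨hUI h1, h2⟩, h1⟩
      rw [hlhs, ← hrhs, h0]
    rw [hx, hz, add_zero]
  · obtain ⟨k, hk⟩ := hUne
    exact ⟨k, by rw [hW]; exact Finset.mem_image_of_mem _ hk⟩

/-! ### The gluing step -/

/-- **The gluing step of Proposition 1** [Gryaznov–Ovcharov–Riazanov 2024, Prop. 1 (proof: "we 'glue'
`i` and `j` … The system `B′v′ = c` has a `WORDER_n`-proper solution `τ`, which satisfies `D_{st}`, by
the induction hypothesis. Now we can extend `τ` by adding `j` and placing immediately before of after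
`i`. Exactly one of such extensions satisfies `f(v) = α`")]: from a proper solution `(r₁, W′)` of the
forms GLUED along `v ↦ u` (values compared with the reference ranking `r` on the unglued forms), on the
ground set `S ∖ {v}` and with a witness for `(s, t)`, to a proper solution on `S` of the unglued forms
`B` AND of the separated form `F₀` (the only form containing the pair `q₀ ∈ {(u,v), (v,u)}`): re-insert
`v` next to `u`, copy `u`'s witnesses to `v` (`liftWit`), and choose the side of `u` by the value
required on `F₀`. [cite: GryaznovOvcharovRiazanov2024, Proposition 1] -/
theorem glue_step {S : Finset ℕ} {r r₁ : ℕ → ℕ} {s t u v : ℕ} {W' : Finset (ℕ × ℕ × ℕ)}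
    {B : List (Finset (ℕ × ℕ) × Finset (ℕ × ℕ × ℕ))} {F₀ : Finset (ℕ × ℕ) × Finset (ℕ × ℕ × ℕ)}
    {q₀ : ℕ × ℕ} (hr₁ : Set.InjOn r₁ (S.erase v : Finset ℕ)) (hu : u ∈ S) (hv : v ∈ S)
    (huv : u ≠ v) (hW' : WProper (S.erase v) r₁ W') (hwit : ∃ k, (s, k, t) ∈ W')
    (hBval : ∀ F ∈ B, pairParity r₁ (parityImage (gluePair u v) F.1) +
        wParity W' (parityImage (glueTriple u v) F.2) = pairParity r F.1)
    (hBpairs : ∀ F ∈ B, ∀ p ∈ F.1, p.1 ∈ S ∧ p.2 ∈ S ∧ p.1 ≠ p.2 ∧ p ≠ (u, v) ∧ p ≠ (v, u))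
    (hq₀ : q₀ ∈ F₀.1) (hq₀uv : q₀ = (u, v) ∨ q₀ = (v, u))
    (hF₀pairs : ∀ p ∈ F₀.1, p ≠ q₀ → p.1 ∈ S ∧ p.2 ∈ S ∧ p.1 ≠ p.2 ∧ p ≠ (u, v) ∧ p ≠ (v, u)) :
    ∃ (r' : ℕ → ℕ) (W : Finset (ℕ × ℕ × ℕ)), Set.InjOn r' S ∧ WProper S r' W ∧
      (∀ F ∈ B, pairParity r' F.1 + wParity W F.2 = pairParity r F.1) ∧
      pairParity r' F₀.1 + wParity W F₀.2 = pairParity r F₀.1 ∧ ∃ k, (s, k, t) ∈ W := by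
  classical
  obtain ⟨hinjA, hinjB⟩ := injOn_lifts (i := u) hr₁
  obtain ⟨hpropA, hpropB⟩ := wProper_liftWit (i := u) hW' hv
  set W := liftWit S u v W' with hWdef
  have hz : ∀ Z, wParity W Z = wParity W' (parityImage (glueTriple u v) Z) :=
    fun Z => wParity_liftWit hW' hv Z
  -- the witness survives (none of `s, k, t` is `v`)
  have hwitW : ∃ k, (s, k, t) ∈ W := by
    obtain ⟨k, hk⟩ := hwit
    obtain ⟨⟨hs', hk', ht'⟩, -⟩ := hW' _ hk
    refine ⟨k, (mem_liftWit_iff hW' hv _).2 ?_⟩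
    unfold glueTriple glue
    simp only [if_neg (Finset.ne_of_mem_erase hs'), if_neg (Finset.ne_of_mem_erase hk'),
      if_neg (Finset.ne_of_mem_erase ht')]
    exact hk
  -- the forms of `B` under both lifts
  have hBlift : ∀ F ∈ B,
      pairParity (liftAfter r₁ u v) F.1 + wParity W F.2 = pairParity r F.1 ∧
        pairParity (liftBefore r₁ u v) F.1 + wParity W F.2 = pairParity r F.1 := by
    intro F hF
    have key := hBval F hF
    rw [← hz] at key
    unfold pairParity at key ⊢
    rw [sum_parityImage] at key
    have hA : ∑ p ∈ F.1, cmpBit (liftAfter r₁ u v) p = ∑ p ∈ F.1, cmpBit r₁ (gluePair u v p) :=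
      Finset.sum_congr rfl fun p hp => by
        obtain ⟨h1, h2, hne, hpuv, hpvu⟩ := hBpairs F hF p hp
        exact (cmpBit_lifts hr₁ hu huv h1 h2 hne hpuv hpvu).1
    have hB : ∑ p ∈ F.1, cmpBit (liftBefore r₁ u v) p = ∑ p ∈ F.1, cmpBit r₁ (gluePair u v p) :=
      Finset.sum_congr rfl fun p hp => by
        obtain ⟨h1, h2, hne, hpuv, hpvu⟩ := hBpairs F hF p hp
        exact (cmpBit_lifts hr₁ hu huv h1 h2 hne hpuv hpvu).2
    exact ⟨by rw [hA]; exact key, by rw [hB]; exact key⟩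
  -- the separated form: the two lifts differ exactly in the bit of `q₀`
  set c : ZMod 2 := ∑ p ∈ F₀.1.erase q₀, cmpBit r₁ (gluePair u v p) with hc
  have hrest : ∀ p ∈ F₀.1.erase q₀,
      cmpBit (liftAfter r₁ u v) p = cmpBit r₁ (gluePair u v p) ∧
        cmpBit (liftBefore r₁ u v) p = cmpBit r₁ (gluePair u v p) := by
    intro p hp
    obtain ⟨hpq, hpF⟩ := Finset.mem_erase.1 hp
    obtain ⟨h1, h2, hne, hpuv, hpvu⟩ := hF₀pairs p hpF hpq
    exact cmpBit_lifts hr₁ hu huv h1 h2 hne hpuv hpvu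
  have hbits : cmpBit (liftAfter r₁ u v) q₀ = cmpBit (liftBefore r₁ u v) q₀ + 1 := by
    rcases hq₀uv with rfl | rfl
    · rw [(cmpBit_lifts_self r₁ huv).1, (cmpBit_lifts_self r₁ huv).2]; decide
    · rw [(cmpBit_lifts_swap_self r₁ huv).1, (cmpBit_lifts_swap_self r₁ huv).2]; decide
  have hA₀ : pairParity (liftAfter r₁ u v) F₀.1 = cmpBit (liftAfter r₁ u v) q₀ + c := by
    unfold pairParity
    rw [← Finset.add_sum_erase _ _ hq₀, hc]
    congr 1
    exact Finset.sum_congr rfl fun p hp => (hrest p hp).1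
  have hB₀ : pairParity (liftBefore r₁ u v) F₀.1 = cmpBit (liftBefore r₁ u v) q₀ + c := by
    unfold pairParity
    rw [← Finset.add_sum_erase _ _ hq₀, hc]
    congr 1
    exact Finset.sum_congr rfl fun p hp => (hrest p hp).2
  by_cases h₀ : pairParity r F₀.1 = cmpBit (liftBefore r₁ u v) q₀ + c + wParity W F₀.2
  · exact ⟨liftBefore r₁ u v, W, hinjB, hpropB, fun F hF => (hBlift F hF).2,
      by rw [hB₀]; exact h₀.symm, hwitW⟩
  · have h₁ := zmod2_eq_add_one_of_ne h₀
    refine ⟨liftAfter r₁ u v, W, hinjA, hpropA, fun F hF => (hBlift F hF).1, ?_, hwitW⟩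
    rw [hA₀, hbits, h₁]; ring

end OrderParity

end Literature.Computability.MetaComplexity
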